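import Literature.AnabelianGeometry.EtaleTheta.Discharge.Sec4GaloisSurjNaturalModel
import Literature.AnabelianGeometry.EtaleTheta.Discharge.Sec5InvariantUnitsOfBiratAction
import Literature.AnabelianGeometry.EtaleTheta.FrobenioidThetaBaseSection
import Literature.AnabelianGeometry.EtaleTheta.Discharge.Sec5TowerRhoNatural
import Literature.AnabelianGeometry.EtaleTheta.Discharge.Sec5TowerOfBiKummerFamilyFacts

/-!
# [EtTh] §5 data assembled over the GENUINE tempered base `D := B^temp(Π^tp_X)` (Def. 4.1 (ii), p.313; §5, pp.330–331 / PDF pp.87, 104–105)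

Mochizuki, *The étale theta function and its Frobenioid-theoretic manifestations*, Publ. RIMS **45** (2009)
[cite: MochizukiEtTh2009, Def 4.1 (ii) p.313 (PDF p.87); §5 p.330–331 (PDF pp.104–105)].  Seat abc-iut-L2-t4 (§5 owner), ROW
W3-L2-01 «§5 GENUINE DATA», junction step (i) of `MERGE-PLAN.md` §2c: the Galois data of the bi-Kummer setting TAKEN FROM THE
TEMPEROID.  Additive; no landed declaration is touched.

Up to `Discharge/Sec5InvariantUnitsOfBiratAction.lean` the §5 data `ThetaFrobenioid.ofBiKummerData` / the tower
`ThetaFrobenioidTower.ofBiKummerFamily` were assembled over an ABSTRACT base category `D` whose Galois objects and surjections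
`Π^tp_X ↠ Aut_D(A)` (Def. 4.1 (ii)) are fields of abc-iut-L2-t3's `BiKummerSetting`; consequently three §5 inputs stayed binders:
`hopen` (the kernel of `Π^tp_X ↠ Aut_D(A_N^bs)` is open), the tower's outer `ρ`-equivariance `ρ_comm_β` along `β^bs_{N,N'}`
(Def. 4.1 (ii) "natural surjective outer homomorphism" + Rmk. 4.3.2), and — through `hdivc`/`hdivp` — the section `σ = s^trv_N`.
Here `D` IS the temperoid `B^temp(Π^tp_X)` of [SemiAnbd] §3 (abc-iut-L3's `BTemp X.Pi`), the Galois objects are those of [SemiAnbd]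
Def. 3.1 (iv) (`IsGaloisObj`) and `Π^tp_X ↠ Aut(A)` is abc-iut-w5-d013's `galoisSurjOf` (Rmk. 3.1.3: `A ≅ Π/N_A`), fed into
abc-iut-L2-t9's canonical model instance `mkOfModelCanonical`:
* `BiKummerSetting.mkOfTemperoid` — the §4 setting over `B^temp(Π^tp_X)`; `H_⊙ = N_{A_⊙}` is an OPEN NORMAL subgroup
  (`Hodot_mkOfTemperoid`, `isOpen_Hodot_mkOfTemperoid` — abc-iut-L2-t3's `Thm44Hyp.isOpen_Hodot` discharged here), the naturality
  law `hS` and the open-kernel law are THEOREMS (`mkOfTemperoid_galoisSurj_natural`, `mkOfTemperoid_isOpen_ker_galoisSurj`);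
* `ThetaFrobenioid.ofTemperoidData` — the §5 data over it with `hopen` DISCHARGED, `σ := strvOfBiKummerData` CONSTRUCTED ([FrdI]
  Prop. 5.6 section of the Frobenius-trivial `A_N`; `hσ` a theorem) and `hdivc`/`hdivp` reduced to the printed divisor invariances
  `hinvc` (p.330: `Div(s^⊓_N)` descends to `A_⊚`) / `hinvp` (Prop. 4.3 (i) proof, p.317); `strvSection_ofTemperoidData`
  unconditional; `biratAutAction_ofTemperoidData`; `facts_ofTemperoidData` ⟸ {`hH` : `Π^tp_Ÿ ⊆ N_{A_⊙}`, `hconst` (Def. 3.6 (iii)),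
  `hgc` (Lemma 5.8 geometric connectedness)} — three printed inputs, every other §5 named input a theorem;
* `ThetaFrobenioidTower.ofTemperoidFamily` — the tower over it with `ρ_comm_β` DISCHARGED by `rho_comm_β_of_natural` +
  `galoisSurjOf_natural` (and `hopen`, `σ`, `hdivc`/`hdivp` as above); `atLevel_ofTemperoidFamily_eq` (levels = `ofTemperoidData`,
  definitionally, at `M ∈ E`); `facts_atLevel_ofTemperoidFamily`.
Residual binders of the assembled data after this file (each a printed input, none a new `Prop` fact): `h` ([FrdI] Thm. 5.2
hypotheses; abc-iut-L2-t3's `hypotheses_treeCatVocab` at the canonical vocabulary), `hinvc`/`hinvp`, `hH`, `hconst`, `hgc`, `hcomp`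
(GAP G-L2t4-1), the Rmk. 4.3.2 transitions with their squares/isometry/degree/base-Frobenius clauses, and the `(N,H)`-saturation /
`A_⊙` parameters of `mkOfModelCanonical`.
HONEST FRAMING: constructions and kernel-checked implications over abc-iut-L2-t3's / abc-iut-L3's DATA structures; nothing asserts
that such data exist for an actual curve; no side is taken on anything downstream ([IUTchIII] Cor. 3.12 in particular).
-/

noncomputable section

namespace Literature.AnabelianGeometry.EtaleTheta

open CategoryTheory Opposite Literature.AlgebraicGeometry.Frobenioids Literature.AnabelianGeometry.SemiGraphs
  Literature.AnabelianGeometry.SemiGraphs.GaloisObjects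

universe u₀ v₀ w

/-! ## The §4 setting over the temperoid `B^temp(Π^tp_X)` -/

namespace BiKummerSetting

variable {K : Type u₀} [Field K] (X : SemiGraphs.TemperedArithmeticGroup.{u₀} K) {D₀ : Type u₀} [Category.{v₀} D₀]
  {V : FrdIMonoidStub.{w}} {T₀ : RealifiedDivisorMonoids (D₀ := D₀) V} {VD : FrdICatStub.{u₀ + 1, u₀, w} (BTemp X.Pi)}
  (tf : TemperedFrobenioid T₀ (BTemp X.Pi) VD) (hZ : tf.monoidType = MonoidType.Z)
  (hP : ∀ A : (BTemp X.Pi)ᵒᵖ, IsPerfect (tf.Φ.carrier A))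
  (NH : Subgroup (Field.absoluteGaloisGroup K) → tf.category → ℕ+ → Prop) (A₀ : tf.category)
  (hA₀ : PreFrobenioid.IsFrobeniusTrivial tf.toElem A₀) (hA₀' : SemiGraphs.IsGaloisObj A₀.base)

/-- **The §4 bi-Kummer setting over the GENUINE tempered base `D := B^temp(Π^tp_X)`** (Def. 4.1, pp.312–313 (PDF pp.86–87)):
abc-iut-L2-t9's canonical model instance `mkOfModelCanonical` with the Galois objects of [SemiAnbd] Def. 3.1 (iv) and the Galois
surjections `Π^tp_X ↠ Aut(A)` of [SemiAnbd] Rmk. 3.1.3 (`galoisSurjOf`, surjective by `galoisSurjOf_surjective`).  Remaining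
parameters: the tempered Frobenioid `tf` over `B^temp(Π^tp_X)` (monoid type `ℤ`, `Φ` perfect), the `(N,H)`-saturation predicate
`NH` ([FrdII] Def. 2.2 (ii)) and the object `A_⊙` (Frobenius-trivial, Galois base).  [cite: MochizukiEtTh2009, Def 4.1 p.313 (PDF p.87)] -/
def mkOfTemperoid : BiKummerSetting X T₀ (BTemp X.Pi) VD :=
  mkOfModelCanonical X tf hZ hP SemiGraphs.IsGaloisObj (fun A h => galoisSurjOf X.isTempered A h)
    (fun A h => galoisSurjOf_surjective X.isTempered A h) NH A₀ hA₀ hA₀'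

/-- `mkOfTemperoid` is `mkOfModelCanonical` fed with the temperoid's Galois data (definitionally).
[cite: MochizukiEtTh2009, Def 4.1 p.313 (PDF p.87)] -/
theorem mkOfTemperoid_eq :
    mkOfTemperoid X tf hZ hP NH A₀ hA₀ hA₀' =
      mkOfModelCanonical X tf hZ hP SemiGraphs.IsGaloisObj (fun A h => galoisSurjOf X.isTempered A h)
        (fun A h => galoisSurjOf_surjective X.isTempered A h) NH A₀ hA₀ hA₀' := rfl

/-- The underlying tempered Frobenioid of `mkOfTemperoid` is `tf` (definitionally). [cite: MochizukiEtTh2009, Def 4.1 p.312 (PDF p.86)] -/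
theorem mkOfTemperoid_tf : (mkOfTemperoid X tf hZ hP NH A₀ hA₀ hA₀').tf = tf := rfl

/-- The Galois surjection of `mkOfTemperoid` at a Galois object is `galoisSurjOf` (definitionally).
[cite: MochizukiEtTh2009, Def 4.1 (ii) p.313 (PDF p.87)] -/
theorem mkOfTemperoid_galoisSurj (A : BTemp X.Pi) (hA : (mkOfTemperoid X tf hZ hP NH A₀ hA₀ hA₀').IsGaloisObj A) :
    (mkOfTemperoid X tf hZ hP NH A₀ hA₀ hA₀').galoisSurj A hA = galoisSurjOf X.isTempered A hA := rfl

/-- **Def. 4.1 (ii), naturality ("natural surjective outer homomorphism") is a THEOREM over the temperoid**: the law `hS` of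
`Discharge/Sec4GaloisSurjNatural.lean` holds for `mkOfTemperoid` — abc-iut-w5-d013's `galoisSurjOf_natural`.
[cite: MochizukiEtTh2009, Def 4.1 (ii) p.313 (PDF p.87)] -/
theorem mkOfTemperoid_galoisSurj_natural :
    ∀ ⦃A B : BTemp X.Pi⦄ (hA : (mkOfTemperoid X tf hZ hP NH A₀ hA₀ hA₀').IsGaloisObj A)
      (hB : (mkOfTemperoid X tf hZ hP NH A₀ hA₀ hA₀').IsGaloisObj B) (b : B ⟶ A), ∃ c : X.Pi, ∀ g : X.Pi,
        ((mkOfTemperoid X tf hZ hP NH A₀ hA₀ hA₀').galoisSurj B hB g).hom ≫ b =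
          b ≫ ((mkOfTemperoid X tf hZ hP NH A₀ hA₀ hA₀').galoisSurj A hA (c * g * c⁻¹)).hom :=
  galoisSurjOf_natural X.isTempered

/-- **The kernel of `Π^tp_X ↠ Aut(A)` is OPEN over the temperoid** (it is the open normal subgroup `N_A` of `A ≅ Π/N_A`, [SemiAnbd]
Rmk. 3.1.3) — the §5 binder `hopen` is a theorem here.  [cite: MochizukiEtTh2009, Def 4.1 (ii) p.313 (PDF p.87)] -/
theorem mkOfTemperoid_isOpen_ker_galoisSurj (A : BTemp X.Pi) (hA : (mkOfTemperoid X tf hZ hP NH A₀ hA₀ hA₀').IsGaloisObj A) :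
    IsOpen (((mkOfTemperoid X tf hZ hP NH A₀ hA₀ hA₀').galoisSurj A hA).ker : Set X.Pi) :=
  isOpen_ker_galoisSurjOf X.isTempered A hA

/-- **`H_⊙ = N_{A_⊙}`** over the temperoid: abc-iut-L2-t3's `H_⊙ := Ker(Π^tp_X ↠ Aut_D(A_⊙^bs))` (p.312 (PDF p.86): "the open
subgroup … determined by `A_⊙`") is the open normal subgroup of the chosen presentation `A_⊙^bs ≅ Π/N_{A_⊙}`.
[cite: MochizukiEtTh2009, Def 4.1 p.312 (PDF p.86)] -/
theorem Hodot_mkOfTemperoid :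
    (mkOfTemperoid X tf hZ hP NH A₀ hA₀ hA₀').Hodot = (galoisQuot X.isTempered A₀.base hA₀').toSubgroup :=
  ker_galoisSurjOf X.isTempered A₀.base hA₀'

/-- `H_⊙` is open over the temperoid (abc-iut-L2-t3's `Thm44Hyp.isOpen_Hodot` discharged). [cite: MochizukiEtTh2009, Def 4.1 p.312 (PDF p.86)] -/
theorem isOpen_Hodot_mkOfTemperoid : IsOpen ((mkOfTemperoid X tf hZ hP NH A₀ hA₀ hA₀').Hodot : Set X.Pi) :=
  isOpen_ker_galoisSurjOf X.isTempered A₀.base hA₀'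

/-- `H_⊙` is normal over the temperoid. [cite: MochizukiEtTh2009, Def 4.1 p.312 (PDF p.86)] -/
theorem Hodot_mkOfTemperoid_normal : ((mkOfTemperoid X tf hZ hP NH A₀ hA₀ hA₀').Hodot).Normal := by
  rw [Hodot_mkOfTemperoid]
  infer_instance

end BiKummerSetting

/-! ## The §5 data over the temperoid: `hopen` discharged, `σ = s^trv_N` constructed -/

namespace ThetaFrobenioid

variable {K : Type u₀} [Field K] {X : SemiGraphs.TemperedArithmeticGroup.{u₀} K} {D₀ : Type u₀} [Category.{v₀} D₀]
  {V : FrdIMonoidStub.{w}} {T₀ : RealifiedDivisorMonoids (D₀ := D₀) V} {VD : FrdICatStub.{u₀ + 1, u₀, w} (BTemp X.Pi)}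
  {tf : TemperedFrobenioid T₀ (BTemp X.Pi) VD} {hZ : tf.monoidType = MonoidType.Z}
  {hP : ∀ A : (BTemp X.Pi)ᵒᵖ, IsPerfect (tf.Φ.carrier A)}
  {NH : Subgroup (Field.absoluteGaloisGroup K) → tf.category → ℕ+ → Prop} {A₀ : tf.category}
  {hA₀ : PreFrobenioid.IsFrobeniusTrivial tf.toElem A₀} {hA₀' : SemiGraphs.IsGaloisObj A₀.base}
  {pullFrac : ∀ {A A' : (BiKummerSetting.mkOfTemperoid X tf hZ hP NH A₀ hA₀ hA₀').C} (_ : A' ⟶ A),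
    (BiKummerSetting.mkOfTemperoid X tf hZ hP NH A₀ hA₀ hA₀').biratUnits A →
      (BiKummerSetting.mkOfTemperoid X tf hZ hP NH A₀ hA₀ hA₀').biratUnits A'}
  {lv N : ℕ+} {T : ThetaEnvData.{max u₀ w} N}
  {θ : (BiKummerSetting.mkOfTemperoid X tf hZ hP NH A₀ hA₀ hA₀').biratUnits
    (BiKummerSetting.mkOfTemperoid X tf hZ hP NH A₀ hA₀ hA₀').Aodot}
  {Bl : (BiKummerSetting.mkOfTemperoid X tf hZ hP NH A₀ hA₀ hA₀').C}
  {Pl : (BiKummerSetting.mkOfTemperoid X tf hZ hP NH A₀ hA₀ hA₀').FractionPair θ Bl}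
  {Rl : (BiKummerSetting.mkOfTemperoid X tf hZ hP NH A₀ hA₀ hA₀').NthRoot θ Pl lv pullFrac}
  (h : ModelFrobenioid.Hypotheses tf.divisorMonoid tf.ratFnFunctor)
  (Q : FrobenioidTheta.ThetaSubquotientStub.{w} (BTemp X.Pi)) (odd_l : Odd (lv : ℕ))
  (R : (BiKummerSetting.mkOfTemperoid X tf hZ hP NH A₀ hA₀ hA₀').NthRoot Rl.root Rl.pair N pullFrac)
  (ιX : T.PiX ≃ₜ* X.Pi) (K' : Type w) [Field K'] (constEmb : K'ˣ →* tf.biratUnitsModel R.BN)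
  (constEmb_injective : Function.Injective constEmb)
  (hinvc : ∀ g : Aut R.AN.base,
    pull tf.divisorMonoid g.hom (ModelFrobenioid.div R.pair.num) = ModelFrobenioid.div R.pair.num)
  (hinvp : ∀ y : T.PiX, y ∈ T.PiYdd →
    pull tf.divisorMonoid (galoisSurjOf X.isTempered R.AN.base R.αData.isGalois (ιX y)).hom
      (ModelFrobenioid.div R.pair.den) = ModelFrobenioid.div R.pair.den)

/-- **The [EtTh] §5 data over the GENUINE tempered base** (§5, pp.330–331 (PDF pp.104–105)): `ofBiKummerData` over
`mkOfTemperoid` (dictionary = identity) with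
* `hopen` DISCHARGED (`isOpen_ker_galoisSurjOf`: `Ker(Π^tp_X ↠ Aut(A_N^bs)) = N_{A_N^bs}` is open);
* `σ = s^trv_N := strvOfBiKummerData` ("the group homomorphism `s^trv_N : Aut_D(A_N^bs) → Aut_C(A_N)` arising from a base-Frobenius
  pair", p.331 — here the [FrdI] Prop. 5.6 section of the Frobenius-trivial `A_N`), so `hσ` is a theorem;
* `hdivc`, `hdivp` from the bare divisor invariances `hinvc` ("the zero divisor `Div(s^⊓_N)` … descends to `A_⊚`", p.330) and
  `hinvp` (Prop. 4.3 (i) proof, p.317: `Div(s''_N)` fixed by `H_{A_N}`) via `hdivc_of_pull_invariant` / `hdivp_of_pull_invariant`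
  (`Φ` divisorial from the [FrdI] Thm. 5.2 hypotheses `h`).
[cite: MochizukiEtTh2009, §5 p.330–331 (PDF pp.104–105)] -/
def ofTemperoidData :
    ThetaFrobenioid.{w} (BiKummerSetting.mkOfTemperoid X tf hZ hP NH A₀ hA₀ hA₀').C (BTemp X.Pi) :=
  ofBiKummerData h (fun _ => MonoidHom.id _) Q odd_l R ιX
    (isOpen_ker_galoisSurjOf X.isTempered R.AN.base R.αData.isGalois) (strvOfBiKummerData h R) K' constEmb
    constEmb_injective
    (hdivc_of_pull_invariant h.isDivisorial R (strvOfBiKummerData h R) (baseMap_strvOfBiKummerData h R) hinvc)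
    (hdivp_of_pull_invariant h.isDivisorial R ιX (strvOfBiKummerData h R) (baseMap_strvOfBiKummerData h R) hinvp)

/-- `ofTemperoidData` unfolds to `ofBiKummerData` with the discharged arguments (definitionally) — so the rfl dictionary and every
theorem of `FrobenioidThetaOfBiKummerData.lean` / `Discharge/Sec5OfModelData.lean` / `Discharge/Sec5InvariantUnitsOfBiratAction.lean`
apply verbatim.  [cite: MochizukiEtTh2009, §5 p.330–331 (PDF pp.104–105)] -/
theorem ofTemperoidData_eq :
    ofTemperoidData h Q odd_l R ιX K' constEmb constEmb_injective hinvc hinvp =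
      ofBiKummerData h (fun _ => MonoidHom.id _) Q odd_l R ιX
        (isOpen_ker_galoisSurjOf X.isTempered R.AN.base R.αData.isGalois) (strvOfBiKummerData h R) K' constEmb
        constEmb_injective
        (hdivc_of_pull_invariant h.isDivisorial R (strvOfBiKummerData h R) (baseMap_strvOfBiKummerData h R) hinvc)
        (hdivp_of_pull_invariant h.isDivisorial R ιX (strvOfBiKummerData h R) (baseMap_strvOfBiKummerData h R)
          hinvp) := rfl

/-- `ρ` of the temperoid data: `Π^tp_X ↠ Aut(A_N^bs)` of [SemiAnbd] Rmk. 3.1.3 conjugated by `(s^⊓_N)^bs : A_N^bs ⥲ B_N^bs`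
(p.331 (PDF p.105)).  [cite: MochizukiEtTh2009, §5 p.331 (PDF p.105)] -/
theorem ofTemperoidData_ρ_apply (g : T.PiX) :
    (ofTemperoidData h Q odd_l R ιX K' constEmb constEmb_injective hinvc hinvp).ρ g =
      (BiKummerSetting.NthRoot.baseIso _ R).conjAut (galoisSurjOf X.isTempered R.AN.base R.αData.isGalois (ιX g)) :=
  rhoOfBiKummerData_apply R ιX g

/-- `s^trv_N` of the temperoid data is the constructed section. [cite: MochizukiEtTh2009, §5 p.331 (PDF p.105)] -/
theorem ofTemperoidData_strv :
    (ofTemperoidData h Q odd_l R ιX K' constEmb constEmb_injective hinvc hinvp).strv = strvOfBiKummerData h R := rfl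

/-- **`StrvSection` is UNCONDITIONAL for the temperoid data** (`σ` constructed). [cite: MochizukiEtTh2009, §5 p.331 (PDF p.105)] -/
theorem strvSection_ofTemperoidData :
    (ofTemperoidData h Q odd_l R ιX K' constEmb constEmb_injective hinvc hinvp).StrvSection :=
  strvSection_ofBiKummerData h _ Q odd_l R ιX _ _ K' constEmb constEmb_injective _ _ (baseMap_strvOfBiKummerData h R)

/-- `SgpCapSpec` for the temperoid data. [cite: MochizukiEtTh2009, §5 p.331 (PDF p.105)] -/
theorem sgpCapSpec_ofTemperoidData :
    (ofTemperoidData h Q odd_l R ιX K' constEmb constEmb_injective hinvc hinvp).SgpCapSpec :=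
  sgpCapSpec_ofBiKummerData h _ Q odd_l R ιX _ _ K' constEmb constEmb_injective _ _

/-- `SgpCupSpec` for the temperoid data. [cite: MochizukiEtTh2009, §5 p.331 (PDF p.105)] -/
theorem sgpCupSpec_ofTemperoidData :
    (ofTemperoidData h Q odd_l R ιX K' constEmb constEmb_injective hinvc hinvp).SgpCupSpec :=
  sgpCupSpec_ofBiKummerData h _ Q odd_l R ιX _ _ K' constEmb constEmb_injective _ _

/-- `SgpCapSection` for the temperoid data. [cite: MochizukiEtTh2009, §5 p.331 (PDF p.105)] -/
theorem sgpCapSection_ofTemperoidData :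
    (ofTemperoidData h Q odd_l R ιX K' constEmb constEmb_injective hinvc hinvp).SgpCapSection :=
  sgpCapSection_ofBiKummerData h _ Q odd_l R ιX _ _ K' constEmb constEmb_injective _ _ (baseMap_strvOfBiKummerData h R)

/-- `AutAmpleBN` for the temperoid data. [cite: MochizukiEtTh2009, §5 p.331 (PDF p.105)] -/
theorem autAmpleBN_ofTemperoidData :
    (ofTemperoidData h Q odd_l R ιX K' constEmb constEmb_injective hinvc hinvp).AutAmpleBN :=
  autAmpleBN_ofBiKummerData h _ Q odd_l R ιX _ _ K' constEmb constEmb_injective _ _ (baseMap_strvOfBiKummerData h R)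

/-- **The natural action on `O^×(B_N^birat)` for the temperoid data** (abc-iut-L2-t11's `BiratAutAction`, instantiated by
abc-iut-L2-t9's `biratAutModel`; input: the constants-fixed law `hconst`, Def. 3.6 (iii)).  [cite: MochizukiEtTh2009, Def 3.6 (iii) p.304 (PDF p.78); Lem 5.8 p.331 (PDF p.105)] -/
def biratAutAction_ofTemperoidData
    (hconst : ∀ (e : Aut R.BN) (k : K'ˣ), tf.biratAutModel R.BN e (constEmb k) = constEmb k) :
    (ofTemperoidData h Q odd_l R ιX K' constEmb constEmb_injective hinvc hinvp).BiratAutAction :=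
  biratAutAction_ofModelData h Q odd_l R ιX _ _ K' constEmb constEmb_injective _ _ hconst

/-- **`Facts` for the §5 data over the temperoid from THREE printed inputs**: `hH` (`Π^tp_Ÿ ⊆ H_⊙ = N_{A_⊙}`, p.322/p.331),
`hconst` (Def. 3.6 (iii)) and `hgc` (Lemma 5.8's geometric connectedness: a unit of `B_N` commuting with `s^⊓-gp_N(Π^tp_Y)` is a
constant) — `hopen`, `hσ`, Prop. 4.3 (iii), the defining relations, Aut-ampleness, total epimorphicity and `ConstantsActByCyclotome`
being THEOREMS.  [cite: MochizukiEtTh2009, §5 p.330–331 (PDF pp.104–105); Lem 5.8 p.331 (PDF p.105)] -/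
theorem facts_ofTemperoidData
    (hH : ∀ y : T.PiX, y ∈ T.PiYdd → ιX y ∈ (BiKummerSetting.mkOfTemperoid X tf hZ hP NH A₀ hA₀ hA₀').Hodot)
    (hconst : ∀ (e : Aut R.BN) (k : K'ˣ), tf.biratAutModel R.BN e (constEmb k) = constEmb k)
    (hgc : ∀ u : (ofTemperoidData h Q odd_l R ιX K' constEmb constEmb_injective hinvc hinvp).units
        (ofTemperoidData h Q odd_l R ιX K' constEmb constEmb_injective hinvc hinvp).BN,
      (∀ y ∈ (ofTemperoidData h Q odd_l R ιX K' constEmb constEmb_injective hinvc hinvp).imPiY,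
        (ofTemperoidData h Q odd_l R ιX K' constEmb constEmb_injective hinvc hinvp).sgpCap y *
          (u : Aut (ofTemperoidData h Q odd_l R ιX K' constEmb constEmb_injective hinvc hinvp).BN) *
          ((ofTemperoidData h Q odd_l R ιX K' constEmb constEmb_injective hinvc hinvp).sgpCap y)⁻¹ = u) →
      (ofTemperoidData h Q odd_l R ιX K' constEmb constEmb_injective hinvc hinvp).unitsToBirat
          (ofTemperoidData h Q odd_l R ιX K' constEmb constEmb_injective hinvc hinvp).BN u ∈
        (ofTemperoidData h Q odd_l R ιX K' constEmb constEmb_injective hinvc hinvp).constEmb.range) :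
    (ofTemperoidData h Q odd_l R ιX K' constEmb constEmb_injective hinvc hinvp).Facts :=
  facts_ofModelData_of_geomConnected h Q odd_l R ιX _ _ K' constEmb constEmb_injective _ _
    (baseMap_strvOfBiKummerData h R) hH hconst rfl hgc

/-- `hH` in print-faithful form over the temperoid: `Π^tp_Ÿ ⊆ N_{A_⊙}` for the chosen presentation `A_⊙^bs ≅ Π^tp_X/N_{A_⊙}`.
[cite: MochizukiEtTh2009, Def 4.1 p.312 (PDF p.86); §5 p.331 (PDF p.105)] -/
theorem hH_of_le_galoisQuot
    (hle : (T.PiYdd).map ιX.toMulEquiv.toMonoidHom ≤ (galoisQuot X.isTempered A₀.base hA₀').toSubgroup) :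
    ∀ y : T.PiX, y ∈ T.PiYdd → ιX y ∈ (BiKummerSetting.mkOfTemperoid X tf hZ hP NH A₀ hA₀ hA₀').Hodot := by
  intro y hy
  rw [BiKummerSetting.Hodot_mkOfTemperoid]
  exact hle (Subgroup.mem_map_of_mem _ hy)

end ThetaFrobenioid

/-! ## The tower over the temperoid: `ρ_comm_β` discharged by naturality -/

namespace ThetaFrobenioidTower

variable {K : Type u₀} [Field K] {X : SemiGraphs.TemperedArithmeticGroup.{u₀} K} {D₀ : Type u₀} [Category.{v₀} D₀]
  {V : FrdIMonoidStub.{w}} {T₀ : RealifiedDivisorMonoids (D₀ := D₀) V} {VD : FrdICatStub.{u₀ + 1, u₀, w} (BTemp X.Pi)}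
  {tf : TemperedFrobenioid T₀ (BTemp X.Pi) VD} {hZ : tf.monoidType = MonoidType.Z}
  {hP : ∀ A : (BTemp X.Pi)ᵒᵖ, IsPerfect (tf.Φ.carrier A)}
  {NH : Subgroup (Field.absoluteGaloisGroup K) → tf.category → ℕ+ → Prop} {A₀ : tf.category}
  {hA₀ : PreFrobenioid.IsFrobeniusTrivial tf.toElem A₀} {hA₀' : SemiGraphs.IsGaloisObj A₀.base}
  {pullFrac : ∀ {A A' : (BiKummerSetting.mkOfTemperoid X tf hZ hP NH A₀ hA₀ hA₀').C} (_ : A' ⟶ A),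
    (BiKummerSetting.mkOfTemperoid X tf hZ hP NH A₀ hA₀ hA₀').biratUnits A →
      (BiKummerSetting.mkOfTemperoid X tf hZ hP NH A₀ hA₀ hA₀').biratUnits A'}
  {lv : ℕ+} {E : Set ℕ+} {𝒯 : ThetaEnvTower.{max u₀ w} E}
  {θ : (BiKummerSetting.mkOfTemperoid X tf hZ hP NH A₀ hA₀ hA₀').biratUnits
    (BiKummerSetting.mkOfTemperoid X tf hZ hP NH A₀ hA₀ hA₀').Aodot}
  {Bl : (BiKummerSetting.mkOfTemperoid X tf hZ hP NH A₀ hA₀ hA₀').C}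
  {Pl : (BiKummerSetting.mkOfTemperoid X tf hZ hP NH A₀ hA₀ hA₀').FractionPair θ Bl}
  {Rl : (BiKummerSetting.mkOfTemperoid X tf hZ hP NH A₀ hA₀ hA₀').NthRoot θ Pl lv pullFrac}
  (h : ModelFrobenioid.Hypotheses tf.divisorMonoid tf.ratFnFunctor)
  (Q : FrobenioidTheta.ThetaSubquotientStub.{w} (BTemp X.Pi)) (odd_l : Odd (lv : ℕ))
  (R : ∀ N : ℕ+, (BiKummerSetting.mkOfTemperoid X tf hZ hP NH A₀ hA₀ hA₀').NthRoot Rl.root Rl.pair N pullFrac)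
  (ιX : 𝒯.PiX ≃ₜ* X.Pi) (K' : Type w) [Field K'] (constEmb : ∀ N : ℕ+, K'ˣ →* tf.biratUnitsModel (R N).BN)
  (constEmb_injective : ∀ N : ℕ+, Function.Injective (constEmb N))
  (hinvc : ∀ (N : ℕ+) (g : Aut (R N).AN.base),
    pull tf.divisorMonoid g.hom (ModelFrobenioid.div (R N).pair.num) = ModelFrobenioid.div (R N).pair.num)
  (hinvp : ∀ (N : ℕ+) (y : 𝒯.PiX), y ∈ 𝒯.PiYdd →
    pull tf.divisorMonoid (galoisSurjOf X.isTempered (R N).AN.base (R N).αData.isGalois (ιX y)).hom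
      (ModelFrobenioid.div (R N).pair.den) = ModelFrobenioid.div (R N).pair.den)
  (α : ∀ {N N' : ℕ+}, (N : ℕ) ∣ N' → ((R N').AN ⟶ (R N).AN))
  (β : ∀ {N N' : ℕ+}, (N : ℕ) ∣ N' → ((R N').BN ⟶ (R N).BN))
  (comm_sCap : ∀ {N N' : ℕ+} (hd : (N : ℕ) ∣ N'), (R N').pair.num ≫ β hd = α hd ≫ (R N).pair.num)
  (comm_sCup : ∀ {N N' : ℕ+} (hd : (N : ℕ) ∣ N'), (R N').pair.den ≫ β hd = α hd ≫ (R N).pair.den)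
  (isIsometry_α : ∀ {N N' : ℕ+} (hd : (N : ℕ) ∣ N'),
    ((BiKummerSetting.mkOfTemperoid X tf hZ hP NH A₀ hA₀ hA₀').sec5Stub h).pre.IsIsometry (α hd))
  (degFr_α : ∀ {N N' : ℕ+} (hd : (N : ℕ) ∣ N'),
    (((BiKummerSetting.mkOfTemperoid X tf hZ hP NH A₀ hA₀ hA₀').sec5Stub h).pre.degFr (α hd) : ℕ) * N = N')
  (isIsometry_β : ∀ {N N' : ℕ+} (hd : (N : ℕ) ∣ N'),
    ((BiKummerSetting.mkOfTemperoid X tf hZ hP NH A₀ hA₀ hA₀').sec5Stub h).pre.IsIsometry (β hd))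
  (degFr_β : ∀ {N N' : ℕ+} (hd : (N : ℕ) ∣ N'),
    (((BiKummerSetting.mkOfTemperoid X tf hZ hP NH A₀ hA₀ hA₀').sec5Stub h).pre.degFr (β hd) : ℕ) * N = N')
  (baseFrob_α : ∀ {N N' : ℕ+} (hd : (N : ℕ) ∣ N'),
    (BiKummerSetting.mkOfTemperoid X tf hZ hP NH A₀ hA₀ hA₀').IsOfBaseFrobeniusType (α hd))

/-- **The tower's outer `ρ`-equivariance `ρ_comm_β` is a THEOREM over the temperoid**: naturality of the Galois surjections
(`galoisSurjOf_natural`, Def. 4.1 (ii)) + the Rmk. 4.3.2 square `comm_sCap`, through `rho_comm_β_of_natural`.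
[cite: MochizukiEtTh2009, Def 4.1 (ii) p.313 (PDF p.87); Rmk 4.3.2 p.318 (PDF p.92)] -/
theorem rho_comm_β_mkOfTemperoid
    (comm_sCap : ∀ {N N' : ℕ+} (hd : (N : ℕ) ∣ N'), (R N').pair.num ≫ β hd = α hd ≫ (R N).pair.num)
    {N N' : ℕ+} (hd : (N : ℕ) ∣ N') :
    ∃ x : 𝒯.PiX, ∀ g : 𝒯.PiX,
      (rhoFamily R ιX N' g).hom ≫ ModelFrobenioid.baseMap (β hd) =
        ModelFrobenioid.baseMap (β hd) ≫ (rhoFamily R ιX N (x * g * x⁻¹)).hom :=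
  rho_comm_β_of_natural R ιX (BiKummerSetting.mkOfTemperoid_galoisSurj_natural X tf hZ hP NH A₀ hA₀ hA₀') α β
    comm_sCap hd

include hinvp in
/-- The tower form of `hdivp_of_pull_invariant` for the constructed sections `s^trv_N` (Prop. 4.3 (i) proof, p.317 (PDF p.91):
`Div(s''_N)` is fixed by `H_{A_N}`; an automorphism has `Div = 0`, `Φ` divisorial).  [cite: MochizukiEtTh2009, Prop 4.3 (i) p.317 (PDF p.91)] -/
theorem div_strv_comp_den_family (N : ℕ+) (y : 𝒯.PiYdd) :
    ModelFrobenioid.div ((ThetaFrobenioid.strvOfBiKummerData h (R N)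
        ((BiKummerSetting.mkOfTemperoid X tf hZ hP NH A₀ hA₀ hA₀').galoisSurj (R N).AN.base (R N).αData.isGalois
          (ιX y.1))).hom ≫ (R N).pair.den) = ModelFrobenioid.div (R N).pair.den := by
  have hc := ModelFrobenioid.div_comp_of_isIso' h.isDivisorial
    (ThetaFrobenioid.strvOfBiKummerData h (R N)
      (galoisSurjOf X.isTempered (R N).AN.base (R N).αData.isGalois (ιX y.1))).hom (R N).pair.den
  rw [ThetaFrobenioid.baseMap_strvOfBiKummerData] at hc
  exact hc.trans (hinvp N y.1 y.2)

/-- **The [EtTh] §5 tower over the GENUINE tempered base** (§5 + Rmk. 4.3.2): `ofBiKummerFamily` over `mkOfTemperoid` with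
`hopen` DISCHARGED at every level, `s^trv_N := strvOfBiKummerData` CONSTRUCTED at every level, `hdivc`/`hdivp` from the divisor
invariances `hinvc`/`hinvp`, and the outer `ρ`-equivariance `ρ_comm_β` along `β^bs_{N,N'}` DISCHARGED by the naturality THEOREM
`galoisSurjOf_natural` (Def. 4.1 (ii)) + the Rmk. 4.3.2 square `comm_sCap` (`rho_comm_β_of_natural`).  Inputs that remain: the
transitions `(α_{N,N'}, β_{N,N'})` with their two squares and the isometry / Frobenius-degree / base-Frobenius-type clauses of
Rmk. 4.3.2 (pp.318–319 (PDF pp.92–93)).  [cite: MochizukiEtTh2009, Rmk 4.3.2 p.318–319 (PDF pp.92–93); §5 p.330–331 (PDF pp.104–105)] -/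
def ofTemperoidFamily :
    ThetaFrobenioidTower.{w} (BiKummerSetting.mkOfTemperoid X tf hZ hP NH A₀ hA₀ hA₀').C (BTemp X.Pi) :=
  ofBiKummerFamily h (fun _ => MonoidHom.id _) Q odd_l R ιX
    (fun N => isOpen_ker_galoisSurjOf X.isTempered (R N).AN.base (R N).αData.isGalois)
    (fun N => ThetaFrobenioid.strvOfBiKummerData h (R N)) K' constEmb constEmb_injective
    (fun N => ThetaFrobenioid.hdivc_of_pull_invariant h.isDivisorial (R N) (ThetaFrobenioid.strvOfBiKummerData h (R N))
      (ThetaFrobenioid.baseMap_strvOfBiKummerData h (R N)) (hinvc N))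
    (div_strv_comp_den_family h R ιX hinvp)
    α β comm_sCap comm_sCup isIsometry_α degFr_α isIsometry_β degFr_β baseFrob_α
    (fun hd => rho_comm_β_mkOfTemperoid R ιX α β comm_sCap hd)

/-- **The levels of the temperoid tower ARE the temperoid §5 data** `ofTemperoidData` over `𝒯.level M` (definitionally, `M ∈ E`).
[cite: MochizukiEtTh2009, §5 p.330–331 (PDF pp.104–105)] -/
theorem atLevel_ofTemperoidFamily_eq (M : E) :
    (ofTemperoidFamily h Q odd_l R ιX K' constEmb constEmb_injective hinvc hinvp α β comm_sCap comm_sCup isIsometry_α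
        degFr_α isIsometry_β degFr_β baseFrob_α).atLevel M =
      ThetaFrobenioid.ofTemperoidData (T := 𝒯.level M) h Q odd_l (R M) ιX K' (constEmb M) (constEmb_injective M)
        (hinvc M) (hinvp M) := rfl

/-- `StrvSection` at every level of the temperoid tower (unconditional). [cite: MochizukiEtTh2009, §5 p.331 (PDF p.105)] -/
theorem strvSection_atLevel_ofTemperoidFamily (N : ℕ+) :
    ((ofTemperoidFamily h Q odd_l R ιX K' constEmb constEmb_injective hinvc hinvp α β comm_sCap comm_sCup isIsometry_α
        degFr_α isIsometry_β degFr_β baseFrob_α).atLevel N).StrvSection := by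
  delta ofTemperoidFamily
  rw [atLevel_ofBiKummerFamily (K' := K') (ρ_comm_β := fun hd => rho_comm_β_mkOfTemperoid R ιX α β comm_sCap hd)]
  exact strvSection_levelData _ _ _ _ _ _ _ _ _ _ _ _ _ (fun N g => ThetaFrobenioid.baseMap_strvOfBiKummerData h (R N) g) N

/-- **`Facts` at every level of the temperoid tower** from `hH` (`Π^tp_Ÿ ⊆ N_{A_⊙}`) and `ConstantsActByCyclotome` at that level.
[cite: MochizukiEtTh2009, §5 p.330–331 (PDF pp.104–105)] -/
theorem facts_atLevel_ofTemperoidFamily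
    (hH : ∀ y : 𝒯.PiX, y ∈ 𝒯.PiYdd → ιX y ∈ (BiKummerSetting.mkOfTemperoid X tf hZ hP NH A₀ hA₀ hA₀').Hodot) (N : ℕ+)
    (hK : ((ofTemperoidFamily h Q odd_l R ιX K' constEmb constEmb_injective hinvc hinvp α β comm_sCap comm_sCup
      isIsometry_α degFr_α isIsometry_β degFr_β baseFrob_α).atLevel N).ConstantsActByCyclotome) :
    ((ofTemperoidFamily h Q odd_l R ιX K' constEmb constEmb_injective hinvc hinvp α β comm_sCap comm_sCup isIsometry_α
        degFr_α isIsometry_β degFr_β baseFrob_α).atLevel N).Facts := by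
  revert hK
  delta ofTemperoidFamily
  rw [atLevel_ofBiKummerFamily (K' := K') (ρ_comm_β := fun hd => rho_comm_β_mkOfTemperoid R ιX α β comm_sCap hd)]
  intro hK
  exact facts_levelData _ _ _ _ _ _ _ _ _ _ _ _ _
    (fun N g => ThetaFrobenioid.baseMap_strvOfBiKummerData h (R N) g) hH
    (fun s' s'' _ _ _ => BiKummerSetting.coe_fracOfModel_mul_unit tf T₀.isUnit_BΛ s' s'')
    (fun e x => BiKummerSetting.coe_biratAutModel_eq_pull tf e x) N hK

end ThetaFrobenioidTower

end Literature.AnabelianGeometry.EtaleTheta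

end
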